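import Summits.AtomisticToContinuum.HydrodynamicLimit.Theorems.AntiMazurCoboundariesCellForecastPressureDecayEntropyBallObjects
import HarnessLib

/-!
# Almost-invariance in total variation, tested against bounded observables (support file of stub
# `stub_kbClosure`, line `entropy-ball-invariant-states` of crux
# `AntiMazurCoboundaries.CellForecastPressureDecay`, stmt-AtomisticToContinuum-13915)

The states of `KrylovBogoliubovClosure` (objects module `…CellForecastPressureDecayEntropyBallObjects`)
are `(2sΛ/T)`-ALMOST INVARIANT in the set-wise form `|μ(Φ_s⁻¹ B) − μ(B)| ≤ 2sΛ/T` for all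
measurable `B`. Step (3) of the proof plan of `stub_kbClosure` (forecast-stationarity of local
limits) consumes this through bounded observables (capped forecast functionals): this file PROVES
the passage

* `abs_integral_sub_integral_le_of_measureReal` — for finite measures `P, Q` with
  `|P(B) − Q(B)| ≤ δ` for all measurable `B` and a measurable `F` with `0 ≤ F ≤ M`:
  `|∫ F dP − ∫ F dQ| ≤ M δ` (layer-cake formula `∫ F = ∫₀^M P{t ≤ F} dt`);
* `abs_integral_comp_flow_sub_integral_le` — for a probability law `μ` on the torus phase space,
  a torus hard-sphere flow `Φ`, a time `s` with `|μ(Φ_s⁻¹ B) − μ(B)| ≤ δ` for all measurable `B`,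
  and a measurable observable `|F| ≤ C`: `|∫ F ∘ Φ_s dμ − ∫ F dμ| ≤ 2 C δ`.

Everything here is proved; no new definitions.
-/

noncomputable section

open MeasureTheory ProbabilityTheory Set Filter Topology
open scoped ENNReal

namespace Summit.AtomisticToContinuum.HydrodynamicLimit.Theorems.EntropyBall

section AlmostInvariance

variable {α : Type*} [MeasurableSpace α]

/-- For a finite measure `P` and a measurable `F`, the tail function `t ↦ P{t ≤ F}` is integrable
on every bounded interval `(0, M]` (it is antitone, hence measurable, and bounded by `P(univ)`). -/
theorem integrableOn_measureReal_le (P : Measure α) [IsFiniteMeasure P] (F : α → ℝ) (M : ℝ) :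
    IntegrableOn (fun t : ℝ => P.real {a | t ≤ F a}) (Ioc 0 M) := by
  have hmeas : Measurable fun t : ℝ => P.real {a | t ≤ F a} := by
    refine Measurable.ennreal_toReal (Antitone.measurable fun s t hst => ?_)
    exact measure_mono fun a (h : t ≤ F a) => hst.trans h
  refine (integrableOn_const (C := P.real univ) (μ := (volume : Measure ℝ)) (s := Ioc 0 M)
    (measure_Ioc_lt_top (μ := (volume : Measure ℝ))).ne).mono' hmeas.aestronglyMeasurable
    (ae_of_all _ fun t => ?_)
  rw [Real.norm_eq_abs, abs_of_nonneg measureReal_nonneg]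
  exact measureReal_mono (subset_univ _)

/-- **Set-wise closeness controls bounded observables.** If two finite measures satisfy
`|P(B) − Q(B)| ≤ δ` for every measurable `B`, then for every measurable `F` with `0 ≤ F ≤ M`,
`|∫ F dP − ∫ F dQ| ≤ M δ` (layer cake: `∫ F dP = ∫_{(0,M]} P{t ≤ F} dt`). [folklore] -/
theorem abs_integral_sub_integral_le_of_measureReal (P Q : Measure α) [IsFiniteMeasure P]
    [IsFiniteMeasure Q] {δ : ℝ} (hPQ : ∀ B : Set α, MeasurableSet B → |P.real B - Q.real B| ≤ δ)
    {F : α → ℝ} (hFm : Measurable F) {M : ℝ} (hM : 0 ≤ M) (hF0 : ∀ a, 0 ≤ F a)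
    (hFM : ∀ a, F a ≤ M) :
    |∫ a, F a ∂P - ∫ a, F a ∂Q| ≤ M * δ := by
  have hint : ∀ (R : Measure α) [IsFiniteMeasure R], Integrable F R := fun R _ =>
    (integrable_const M).mono' hFm.aestronglyMeasurable
      (ae_of_all _ fun a => by rw [Real.norm_eq_abs, abs_of_nonneg (hF0 a)]; exact hFM a)
  rw [(hint P).integral_eq_integral_Ioc_meas_le (ae_of_all _ hF0) (ae_of_all _ hFM),
    (hint Q).integral_eq_integral_Ioc_meas_le (ae_of_all _ hF0) (ae_of_all _ hFM),
    ← integral_sub (integrableOn_measureReal_le P F M) (integrableOn_measureReal_le Q F M)]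
  have hvol : (volume : Measure ℝ).real (Ioc 0 M) = M := by
    rw [measureReal_def, Real.volume_Ioc, sub_zero, ENNReal.toReal_ofReal hM]
  calc |∫ t in Ioc 0 M, (P.real {a | t ≤ F a} - Q.real {a | t ≤ F a})|
      ≤ δ * (volume : Measure ℝ).real (Ioc 0 M) := by
        rw [← Real.norm_eq_abs]
        refine norm_setIntegral_le_of_norm_le_const measure_Ioc_lt_top fun t _ => ?_
        rw [Real.norm_eq_abs]
        exact hPQ _ (measurableSet_le measurable_const hFm)
    _ = M * δ := by rw [hvol, mul_comm]

/-- The signed version for `|F| ≤ C`: `|∫ F dP − ∫ F dQ| ≤ 2 C δ` for PROBABILITY measures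
(apply the previous bound to `F + C ∈ [0, 2C]`; the added constants cancel). [folklore] -/
theorem abs_integral_sub_integral_le_of_measureReal' (P Q : Measure α) [IsProbabilityMeasure P]
    [IsProbabilityMeasure Q] {δ : ℝ} (hPQ : ∀ B : Set α, MeasurableSet B → |P.real B - Q.real B| ≤ δ)
    {F : α → ℝ} (hFm : Measurable F) {C : ℝ} (hFC : ∀ a, |F a| ≤ C) :
    |∫ a, F a ∂P - ∫ a, F a ∂Q| ≤ 2 * C * δ := by
  have hne : Nonempty α := by
    by_contra h
    have h1 : P univ = 1 := measure_univ
    rw [univ_eq_empty_iff.2 (not_nonempty_iff.1 h), measure_empty] at h1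
    exact zero_ne_one h1
  have hC : 0 ≤ C := (abs_nonneg _).trans (hFC hne.some)
  have hint : ∀ (R : Measure α) [IsFiniteMeasure R], Integrable F R := fun R _ =>
    (integrable_const C).mono' hFm.aestronglyMeasurable
      (ae_of_all _ fun a => by rw [Real.norm_eq_abs]; exact hFC a)
  have h := abs_integral_sub_integral_le_of_measureReal P Q hPQ (hFm.add_const C)
    (by positivity : (0 : ℝ) ≤ 2 * C) (fun a => by linarith [neg_abs_le (F a), hFC a])
    (fun a => by linarith [le_abs_self (F a), hFC a])
  rw [integral_add (hint P) (integrable_const C), integral_add (hint Q) (integrable_const C),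
    integral_const, integral_const, probReal_univ, probReal_univ] at h
  calc |∫ a, F a ∂P - ∫ a, F a ∂Q|
      = |∫ a, F a ∂P + (1 : ℝ) • C - (∫ a, F a ∂Q + (1 : ℝ) • C)| := by ring_nf
    _ ≤ 2 * C * δ := h

/-- **Almost-invariant torus states tested against bounded observables.** For a probability law
`μ` on the torus phase space, a torus hard-sphere flow `Φ`, a time `s` at which
`|μ(Φ_s⁻¹ B) − μ(B)| ≤ δ` for all measurable `B` (the hypothesis of `KrylovBogoliubovClosure` at
time `s`, `δ = 2sΛ/T`), and a measurable observable `|F| ≤ C`: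
`|∫ F ∘ Φ_s dμ − ∫ F dμ| ≤ 2 C δ`. [folklore] -/
theorem abs_integral_comp_flow_sub_integral_le {ε : ℝ} {n : ℕ} (Φ : TorusFlow ε n)
    (μ : Measure (TorusPhase n)) [IsProbabilityMeasure μ] {s δ : ℝ}
    (hAI : ∀ B : Set (TorusPhase n), MeasurableSet B →
      |(μ (Φ.flow s ⁻¹' B)).toReal - (μ B).toReal| ≤ δ)
    {F : TorusPhase n → ℝ} (hFm : Measurable F) {C : ℝ} (hFC : ∀ z, |F z| ≤ C) :
    |∫ z, F (Φ.flow s z) ∂μ - ∫ z, F z ∂μ| ≤ 2 * C * δ := by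
  have hΦ : Measurable (Φ.flow s) := Φ.measurable_flow s
  haveI : IsProbabilityMeasure (μ.map (Φ.flow s)) := Measure.isProbabilityMeasure_map hΦ.aemeasurable
  have hPQ : ∀ B : Set (TorusPhase n), MeasurableSet B →
      |(μ.map (Φ.flow s)).real B - μ.real B| ≤ δ := fun B hB => by
    rw [measureReal_def, measureReal_def, Measure.map_apply hΦ hB]
    exact hAI B hB
  have h := abs_integral_sub_integral_le_of_measureReal' (μ.map (Φ.flow s)) μ hPQ hFm hFC
  rwa [integral_map hΦ.aemeasurable hFm.aestronglyMeasurable] at h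

/-- S3-track helper stub (line entropy-ball-invariant-states): set-wise closeness of two finite
measures controls bounded observables (`|∫F dP − ∫F dQ| ≤ Mδ` for `0 ≤ F ≤ M`, `≤ 2Cδ` for `|F| ≤ C`
and probability measures), and the almost-invariance hypothesis of `KrylovBogoliubovClosure` tested
against bounded measurable observables along a torus hard-sphere flow. -/
theorem stub_kbAlmostInvariance :
    (∀ (α : Type) [MeasurableSpace α] (P Q : Measure α) [IsFiniteMeasure P] [IsFiniteMeasure Q] (δ : ℝ), (∀ B : Set α, MeasurableSet B → |P.real B - Q.real B| ≤ δ) → ∀ (F : α → ℝ), Measurable F → ∀ M : ℝ, 0 ≤ M → (∀ a, 0 ≤ F a) → (∀ a, F a ≤ M) → |∫ a, F a ∂P - ∫ a, F a ∂Q| ≤ M * δ) ∧ (∀ (α : Type) [MeasurableSpace α] (P Q : Measure α) [IsProbabilityMeasure P] [IsProbabilityMeasure Q] (δ : ℝ), (∀ B : Set α, MeasurableSet B → |P.real B - Q.real B| ≤ δ) → ∀ (F : α → ℝ), Measurable F → ∀ C : ℝ, (∀ a, |F a| ≤ C) → |∫ a, F a ∂P - ∫ a, F a ∂Q| ≤ 2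 * C * δ) ∧ (∀ (ε : ℝ) (n : ℕ) (Φ : TorusFlow ε n) (μ : Measure (TorusPhase n)) [IsProbabilityMeasure μ] (s δ : ℝ), (∀ B : Set (TorusPhase n), MeasurableSet B → |(μ (Φ.flow s ⁻¹' B)).toReal - (μ B).toReal| ≤ δ) → ∀ (F : TorusPhase n → ℝ), Measurable F → ∀ C : ℝ, (∀ z, |F z| ≤ C) → |∫ z, F (Φ.flow s z) ∂μ - ∫ z, F z ∂μ| ≤ 2 * C * δ) :=
  ⟨fun _ _ P Q _ _ _ hPQ _ hFm _ hM hF0 hFM =>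
      abs_integral_sub_integral_le_of_measureReal P Q hPQ hFm hM hF0 hFM,
    fun _ _ P Q _ _ _ hPQ _ hFm _ hFC => abs_integral_sub_integral_le_of_measureReal' P Q hPQ hFm hFC,
    fun _ _ Φ μ _ _ _ hAI _ hFm _ hFC => abs_integral_comp_flow_sub_integral_le Φ μ hAI hFm hFC⟩

end AlmostInvariance

end Summit.AtomisticToContinuum.HydrodynamicLimit.Theorems.EntropyBall

end
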